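import Summits.CriticalPhenomena.SAWScalingLimit.Theorems.SAWTotalPositivityCriticalBubbleBoundJoinBigDefs

/-!
# The termwise (uniform-`SAP_N`) interface of the size knob of the join-mass ledger
(crux `SAWTotalPositivity.CriticalBubbleBound`, stmt-CriticalPhenomena-7117; line `docking-census-joining`,
registered stub `bigMassFraction_of_termwise` of the join-mass programme, lead prover c7)

`bigMassFraction_of_termwise`: the block statement `BigMassFraction ν'` (for all large `i`, a fixed
fraction `c` of the critical mass `R'_i = blockMass jterm i` of the dyadic block `B_i` is carried by BIG
classes, i.e. classes of linear size `max (height, width) ≥ 2^{ν' i}`) follows from its TERMWISE form: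
for all large `i`, at every walk length `n - 17` with `n ∈ B_i` (and `n ≥ 17`), at least a fraction `c`
of the lex-rooted classes `lexRooted (n - 17)` — that is, of the uniform self-avoiding polygons with
`N = n - 16` edges, one lex-rooted representative per translation class — is big at scale `i`.
Multiplying the length-by-length inequality `c · #lexRooted (n-17) ≤ #{χ ∈ lexRooted (n-17) : IsBigAt}`
by the common class weight `x_c^{n-16} ≥ 0` and summing over the block gives
`c · blockMass jterm i ≤ bigMass ν' i` (below the shift both sides vanish).

This is the form in which the size hypothesis is measured numerically (uniform `SAP_N` sampling:
`P_N (max (h, w) ≥ N^{0.625}) ≥ 0.95` for `N ≥ 128`); conjecturally it holds for every `ν' < ν = 3/4`.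
No conjecture is asserted here: the file only reduces the block statement to the termwise one.
[cite: Hammond2015SAPJoining, Lemma 4.12] [cite: MadrasSlade1993, §1.1]
-/

noncomputable section

open Literature.Probability.LatticeModels
open Literature.Probability.RandomPlanarGeometry Literature.Probability.RandomPlanarGeometry.SAW
open scoped BigOperators
open Summit.CriticalPhenomena.SAWScalingLimit.Theorems.CriticalBubbleBound.Negative (e₀)
open Summit.CriticalPhenomena.SAWScalingLimit.Theorems.CriticalBubbleBound.Docking

namespace Summit.CriticalPhenomena.SAWScalingLimit.Theorems.CriticalBubbleBound.Join

/-! ## From the termwise fraction bound to the block statement -/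

open Classical in
/-- **Termwise interface of the size knob.** If for all large `i`, at every shifted length `n ∈ B_i`
with `n ≥ 17`, at least a fraction `c > 0` of the lex-rooted classes of walk length `n - 17` is big at
scale `i` (`max (height, width) ≥ 2^{ν' i}`), then `BigMassFraction ν'` holds (with the same `c` and
the same threshold `i₀`): multiply termwise by the class weight `x_c^{n-17+1}` and sum over the block.
[cite: Hammond2015SAPJoining, Lemma 4.12] -/
theorem bigMassFraction_of_termwise : ∀ (ν' c : ℝ), 0 < c → (∃ i₀ : ℕ, ∀ i : ℕ, i₀ ≤ i → ∀ n ∈ block i, joinShift ≤ n → c * ((lexRooted (n - joinShift)).card : ℝ) ≤ (((lexRooted (n - joinShift)).filter fun χ => IsBigAt ν' i (n - joinShift) χ).card : ℝ)) → BigMassFraction ν' := by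
  intro ν' c hc hex
  obtain ⟨i₀, h⟩ := hex
  refine ⟨c, hc, i₀, fun i hi => ?_⟩
  rw [blockMass, bigMass, Finset.mul_sum]
  refine Finset.sum_le_sum fun n hn => ?_
  split_ifs with hle
  · rw [jterm_of_le hle, cterm, ← mul_assoc]
    exact mul_le_mul_of_nonneg_right (h i hi n hn hle) (pow_nonneg criticalFugacity_pos_lt_one'.1.le _)
  · rw [jterm_of_lt (not_le.1 hle), mul_zero]

end Summit.CriticalPhenomena.SAWScalingLimit.Theorems.CriticalBubbleBound.Join

end
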